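import Summits.Ventures.CertifiedManyBodySolver.Observables.BraggWeightWiener
import Summits.Ventures.CertifiedManyBodySolver.Rows.DopedTLPairDominance
import Literature.MathematicalPhysics.QuantumLattice.InfVolFermionStateCorrelationPositiveDefinite
import HarnessLib

/-!
# The pair-ODLRO ceiling in the thermodynamic limit: a certified UPPER bound on a box pair sum
# `Σ_{x,y∈B} Re ω(Φ_x† Φ_y)` is a certified ceiling `|B|⁻² Σ` on the `d`-wave pair Bragg weight at `Q = 0`

HONEST FRAMING: first certified bounds on pairing observables; not a superconductivity verdict; every
number certified (two lineages + referee) or labelled float. Crew hubbard-obs (D-0042), seat hubbard-obs-p1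
(`prover-hubbard-obs-p1-g0-0`); spec HOME/obs-p1/PAIRCORR-SDP.md §4 (O2). Pure harmonic analysis +
positivity of states; zero compute; no named fact, no `sorry`; ONE auxiliary definition (`pairBoxWord`, the
objective WORD of the certificate, so that the rows of `Rows/DopedTLCorr*.lean` can name it).

The pairing twin of the stripe-order ceilings (`Observables/StripeOrderKernels.lean`,
`StripeOrderKernelCeiling.lean`, CERTIFIED #258–#263 / #301–#303): there a certified window on a
Fejér-weighted spin / charge window sum is a certified ceiling on the Bragg weight of the representing
measure at the stripe star; here the wavevector is `Q = 0` and the lattice function is the PAIR two-point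
function `C(r) = ω(Φ_0† Φ_r)` of a translation-invariant state (`ω.pairCorr S g 0 r`; the tree's d-wave
pair `ω.dWavePairCorr 0 r`), whose Bragg weight at `0` is the off-diagonal long-range-order density of the
pairs `Φ` — the thermodynamic-limit quantity whose positivity is the LRO clause of `HubbardSuperconductivity`
read in a translation-invariant ground state (Wiener: `tendsto_boxPairMean_re_braggWeight`, the box
structure-factor means `M⁻⁴ Σ_{x,y∈[0,M)²} C(x − y)` converge to it).

* §1 `sq_card_mul_braggWeight_zero_le` (any `d`, any finite measure `μ` representing a lattice function
  `C : ℤᵈ → ℂ`, ANY finite `B ⊂ ℤᵈ`): **`|B|² · braggWeight μ ![0] ≤ Σ_{x,y∈B} Re C(y − x)`**. Kernel: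
  `K_B(ξ) = Σ_{x,y∈B} cos((y−x)·ξ) = (Σ_{x∈B} cos x·ξ)² + (Σ_{x∈B} sin x·ξ)² ≥ 0`, `K_B = |B|²` on `2πℤᵈ`
  (the box `B = [0,M)ᵈ` gives the Fejér kernel; no box structure is needed).
* §2 the pair two-point function of a translation-invariant `ω : InfVolFermionState 2` is positive
  definite (`isPositiveDefinite_pairCorr`, from the tree's `IsTranslationInvariant.isPositiveDefinite_corr`),
  hence representable (Herglotz, `exists_representing_pairCorr`), and for EVERY representing `μ` and every
  finite `B`: **`|B|² · braggWeight μ ![0] ≤ Σ_{x,y∈B} Re ω.pairCorr S g x y`**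
  (`sq_card_mul_braggWeight_le_sum_re_pairCorr`; d-wave `…_dWavePairCorr`); the `B = {x}` rung is the
  local pair density ceiling `braggWeight ≤ Re ω(Φ_0†Φ_0)` (`braggWeight_le_re_pairCorr_self`, today's
  certified number via #290-type rows), and by diagonal dominance NO box beats it kinematically
  (`sum_sum_re_pairCorr_le`): only a certificate that knows `Re ω(Φ_x†Φ_y)` is small off the diagonal does.
* §3 the certificate side: the box pair WORD `pairBoxWord S g B = Σ_{x,y∈B} Γ(Φ_x)† Γ(Φ_y)` in the window
  `B.biUnion (pairRegion S)`, `ω(pairBoxWord) = Σ_{x,y∈B} ω.pairCorr S g x y` (`expect_pairBoxWord`), and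
  the row ⇒ ceiling edges: a one-row UPPER cell `SquareTTPrimeCorrUpperRow tp U n u fu _ (pairBoxWord …)`
  (energy cap `u` certified) gives `braggWeight μ ![0] ≤ fu / |B|²` for every torus-limit ground state of
  the class and every measure representing its pair correlation function
  (`braggWeight_le_of_pairBox_upperRow`; M3′ d-wave form `m3_dWavePair_braggWeight_le_of_upperRow`).
  The two-row (`lo ≤ e₀ ≤ hi`) edge is the same term applied to `Rows/DopedTLCorrWindow.lean`'s rows.

References: Scalapino, Phys. Rep. 250 (1995) 329, §2 eq. (2.3)–(2.4); Sewell, J. Math. Phys. 11 (1970)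
1868, §4; Katznelson, *An Introduction to Harmonic Analysis*, I.7 (Herglotz); Bratteli–Robinson I
§2.3.3 / Cor. 2.3.17.
-/

noncomputable section

open MeasureTheory Complex Filter Topology
open scoped Real BigOperators

namespace Summit.Ventures.CertifiedManyBodySolver.Observables

/-! ## §1  The `Q = 0` kernel ceiling for an arbitrary finite set of lattice points -/

section General

variable {d : ℕ}

/-- `Σ_{x,y∈B} cos(θ_y − θ_x) = (Σ_{x∈B} cos θ_x)² + (Σ_{x∈B} sin θ_x)²`. -/
theorem sum_sum_cos_sub_eq_sq_add_sq {ι : Type*} (B : Finset ι) (θ : ι → ℝ) :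
    ∑ x ∈ B, ∑ y ∈ B, Real.cos (θ y - θ x) =
      (∑ x ∈ B, Real.cos (θ x)) ^ 2 + (∑ x ∈ B, Real.sin (θ x)) ^ 2 := by
  simp_rw [Real.cos_sub]
  rw [sq, sq, Finset.sum_mul_sum, Finset.sum_mul_sum, ← Finset.sum_add_distrib]
  refine Finset.sum_congr rfl fun x _ => ?_
  rw [← Finset.sum_add_distrib]
  exact Finset.sum_congr rfl fun y _ => by ring

/-- Hence `0 ≤ Σ_{x,y∈B} cos(θ_y − θ_x)`. -/
theorem sum_sum_cos_sub_nonneg {ι : Type*} (B : Finset ι) (θ : ι → ℝ) :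
    0 ≤ ∑ x ∈ B, ∑ y ∈ B, Real.cos (θ y - θ x) := by
  rw [sum_sum_cos_sub_eq_sq_add_sq]; positivity

variable {C : (Fin d → ℤ) → ℂ} (μ : Measure (EuclideanSpace ℝ (Fin d))) [IsFiniteMeasure μ]

/-- **The `Q = 0` ceiling from any finite set of lattice points.** For a finite measure `μ` on `ℝᵈ`
representing `C : ℤᵈ → ℂ` (`∫ exp (i r·ξ) dμ = C r`) and every finite `B ⊂ ℤᵈ`:
`|B|² · braggWeight μ ![0] ≤ Σ_{x∈B} Σ_{y∈B} Re C(y − x)`.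
Proof: the kernel `K_B(ξ) = Σ_{x,y∈B} cos((y−x)·ξ) = |Σ_{x∈B} e^{ix·ξ}|² ≥ 0` equals `|B|²` on `2πℤᵈ`,
so `|B|² μ(2πℤᵈ) = ∫_{2πℤᵈ} K_B ≤ ∫ K_B = Σ Re C(y − x)`. Katznelson I.7; Hirsch PRB 31 (1985) 4403 eq. (4.7). -/
theorem sq_card_mul_braggWeight_zero_le
    (hμ : ∀ r : Fin d → ℤ, ∫ ξ, exp ((∑ i, (r i : ℝ) * ξ i : ℝ) * I) ∂μ = C r)
    (B : Finset (Fin d → ℤ)) :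
    ((B.card : ℝ)) ^ 2 * braggWeight μ ![(0 : Fin d → ℝ)] ≤ ∑ x ∈ B, ∑ y ∈ B, (C (y - x)).re := by
  set A : Set (EuclideanSpace ℝ (Fin d)) := ⋃ j : Fin 1, braggSet ((![(0 : Fin d → ℝ)]) j) with hA
  set K : EuclideanSpace ℝ (Fin d) → ℝ :=
    fun ξ => ∑ x ∈ B, ∑ y ∈ B, Real.cos (∑ i, ((y - x) i : ℝ) * ξ i) with hKdef
  -- the phases `θ_x = x·ξ`
  have hθ : ∀ (ξ : EuclideanSpace ℝ (Fin d)) (x y : Fin d → ℤ),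
      (∑ i, ((y - x) i : ℝ) * ξ i) = (∑ i, (y i : ℝ) * ξ i) - ∑ i, (x i : ℝ) * ξ i := by
    intro ξ x y
    rw [← Finset.sum_sub_distrib]
    refine Finset.sum_congr rfl fun i _ => ?_
    rw [Pi.sub_apply]; push_cast; ring
  have hKnn : ∀ ξ, 0 ≤ K ξ := by
    intro ξ
    rw [hKdef]; dsimp only
    simp_rw [hθ ξ]
    exact sum_sum_cos_sub_nonneg B (fun x : Fin d → ℤ => ∑ i, (x i : ℝ) * ξ i)
  have hKcont : Continuous K := by rw [hKdef]; fun_prop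
  have hKbd : ∀ ξ, ‖K ξ‖ ≤ ((B.card : ℝ)) ^ 2 := by
    intro ξ
    rw [hKdef, Real.norm_eq_abs]; dsimp only
    refine (Finset.abs_sum_le_sum_abs _ _).trans ?_
    calc ∑ x ∈ B, |∑ y ∈ B, Real.cos (∑ i, ((y - x) i : ℝ) * ξ i)|
        ≤ ∑ x ∈ B, ∑ y ∈ B, |Real.cos (∑ i, ((y - x) i : ℝ) * ξ i)| :=
          Finset.sum_le_sum fun x _ => Finset.abs_sum_le_sum_abs _ _
      _ ≤ ∑ _x ∈ B, ∑ _y ∈ B, (1 : ℝ) :=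
          Finset.sum_le_sum fun x _ => Finset.sum_le_sum fun y _ => Real.abs_cos_le_one _
      _ = ((B.card : ℝ)) ^ 2 := by
          simp only [Finset.sum_const, nsmul_eq_mul, mul_one]; ring
  have hKint : Integrable K μ :=
    Integrable.mono' (integrable_const _) hKcont.aestronglyMeasurable (ae_of_all _ hKbd)
  -- on `2πℤᵈ` every cosine is `1`
  have hKA : ∀ ξ ∈ A, K ξ = ((B.card : ℝ)) ^ 2 := by
    intro ξ hξ
    rw [hA, Set.mem_iUnion] at hξ
    obtain ⟨j, hj⟩ := hξ
    obtain rfl : j = 0 := Subsingleton.elim _ _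
    rw [Matrix.cons_val_zero] at hj
    obtain ⟨mv, hm⟩ := hj
    rw [hKdef]; dsimp only
    have hcos : ∀ x y : Fin d → ℤ, Real.cos (∑ i, ((y - x) i : ℝ) * ξ i) = 1 := by
      intro x y
      have : (∑ i, ((y - x) i : ℝ) * ξ i) = ((∑ i, (y - x) i * mv i : ℤ) : ℝ) * (2 * π) := by
        push_cast
        rw [Finset.sum_mul]
        exact Finset.sum_congr rfl fun i _ => by rw [hm i, Pi.zero_apply]; ring
      rw [this, Real.cos_int_mul_two_pi]
    simp_rw [hcos]
    simp only [Finset.sum_const, nsmul_eq_mul, mul_one]; ring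
  have hAmeas : MeasurableSet A := MeasurableSet.iUnion fun j => measurableSet_braggSet _
  -- each cosine is integrable; the integral of `K` is the window sum
  have hcosInt : ∀ x y : Fin d → ℤ,
      Integrable (fun ξ : EuclideanSpace ℝ (Fin d) => Real.cos (∑ i, ((y - x) i : ℝ) * ξ i)) μ := by
    intro x y
    refine Integrable.mono' (integrable_const (1 : ℝ)) (by fun_prop) (ae_of_all _ fun ξ => ?_)
    rw [Real.norm_eq_abs]
    exact Real.abs_cos_le_one _
  have hKI : ∫ ξ, K ξ ∂μ = ∑ x ∈ B, ∑ y ∈ B, (C (y - x)).re := by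
    rw [hKdef]; dsimp only
    rw [integral_finsetSum _ fun x _ => integrable_finsetSum _ fun y _ => hcosInt x y]
    refine Finset.sum_congr rfl fun x _ => ?_
    rw [integral_finsetSum _ fun y _ => hcosInt x y]
    exact Finset.sum_congr rfl fun y _ => integral_cos_eq_re μ hμ (y - x)
  unfold braggWeight
  calc ((B.card : ℝ)) ^ 2 * (μ A).toReal
      = ∫ _ξ in A, ((B.card : ℝ)) ^ 2 ∂μ := by
        rw [setIntegral_const, Measure.real, smul_eq_mul, mul_comm]
    _ = ∫ ξ in A, K ξ ∂μ := setIntegral_congr_fun hAmeas fun ξ hξ => (hKA ξ hξ).symm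
    _ ≤ ∫ ξ, K ξ ∂μ := setIntegral_le_integral hKint (ae_of_all _ hKnn)
    _ = ∑ x ∈ B, ∑ y ∈ B, (C (y - x)).re := hKI

/-- The normalised form: `braggWeight μ ![0] ≤ |B|⁻² Σ_{x,y∈B} Re C(y − x)` for nonempty `B`. -/
theorem braggWeight_zero_le_boxAvg
    (hμ : ∀ r : Fin d → ℤ, ∫ ξ, exp ((∑ i, (r i : ℝ) * ξ i : ℝ) * I) ∂μ = C r)
    {B : Finset (Fin d → ℤ)} (hB : B.Nonempty) :
    braggWeight μ ![(0 : Fin d → ℝ)] ≤ (∑ x ∈ B, ∑ y ∈ B, (C (y - x)).re) / ((B.card : ℝ)) ^ 2 := by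
  have hpos : 0 < ((B.card : ℝ)) ^ 2 := by
    have : 0 < (B.card : ℝ) := by exact_mod_cast hB.card_pos
    positivity
  rw [le_div_iff₀ hpos, mul_comm]
  exact sq_card_mul_braggWeight_zero_le μ hμ B

end General

/-! ## §2  The pair two-point function of a translation-invariant state -/

section Pair

open Matrix Literature.MathematicalPhysics.QuantumLattice Literature.Probability.LatticeModels
open Literature.Analysis.FunctionSpaces

variable (S : Finset (Site 2)) (g : Site 2 → ℝ)

/-- The translate of the pair at the origin is the pair at `r`, inside the two-point function:
`ω(Φ_0† · τ_r Φ_0) = ω.pairCorr S g 0 r`. Sewell 1970 §4. -/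
theorem corr_conjTranspose_shiftEmb_localPairAt (ω : InfVolFermionState 2) (r : Site 2) :
    ω.corr (localPairAt S g 0)ᴴ (fermionEmbed (PolySite.shiftEmb r (pairRegion S 0)) (localPairAt S g 0)) =
      ω.pairCorr S g 0 r := by
  have h1 : ω.corr (localPairAt S g 0)ᴴ
      (fermionEmbed (PolySite.shiftEmb r (pairRegion S 0)) (localPairAt S g 0)) = ω.pairCorr S g 0 (0 + r) := by
    rw [InfVolFermionState.pairCorr, fermionEmbed_shiftEmb_localPairAt]
    have h := ω.corr_fermionEmbed_incl subset_rfl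
      (Finset.subset_of_eq (shiftSet_pairRegion r S 0).symm) (localPairAt S g 0)ᴴ (localPairAt S g (0 + r))
    rw [PolySite.incl_rfl, fermionEmbed_refl_apply] at h
    exact h
  rw [zero_add] at h1
  exact h1

/-- **The pair two-point function of a translation-invariant state is positive definite**
(`r ↦ ω(Φ_0† Φ_r)`; Bochner's convention). Bratteli–Robinson I Cor. 2.3.17; Sewell 1970 §4. -/
theorem isPositiveDefinite_pairCorr {ω : InfVolFermionState 2} (hω : ω.IsTranslationInvariant) :
    IsPositiveDefinite (fun r : Site 2 => ω.pairCorr S g 0 r) := by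
  have h := hω.isPositiveDefinite_corr (localPairAt S g 0)
  have hfun : (fun r : Site 2 => ω.corr (localPairAt S g 0)ᴴ
      (fermionEmbed (PolySite.shiftEmb r (pairRegion S 0)) (localPairAt S g 0))) =
      fun r : Site 2 => ω.pairCorr S g 0 r :=
    funext fun r => corr_conjTranspose_shiftEmb_localPairAt S g ω r
  rw [hfun] at h
  exact h

/-- The `d`-wave case: `r ↦ ω.dWavePairCorr 0 r` is positive definite. -/
theorem isPositiveDefinite_dWavePairCorr {ω : InfVolFermionState 2} (hω : ω.IsTranslationInvariant) :
    IsPositiveDefinite (fun r : Site 2 => ω.dWavePairCorr 0 r) :=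
  isPositiveDefinite_pairCorr (insert 0 unitSteps) dWaveFormFactor hω

/-- **Herglotz**: the pair two-point function of a translation-invariant state is represented by a
finite measure on `ℝ²` (the pair spectral measure; its atom at `0` is the pair ODLRO density). -/
theorem exists_representing_pairCorr {ω : InfVolFermionState 2} (hω : ω.IsTranslationInvariant) :
    ∃ μ : Measure (EuclideanSpace ℝ (Fin 2)), IsFiniteMeasure μ ∧
      ∀ r : Site 2, ∫ ξ, exp ((∑ i, (r i : ℝ) * ξ i : ℝ) * I) ∂μ = ω.pairCorr S g 0 r :=
  (isPositiveDefinite_pairCorr S g hω).exists_measure_integral_exp_eq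

/-- Translation invariance in the form used by box sums: `ω.pairCorr S g 0 (y − x) = ω.pairCorr S g x y`. -/
theorem pairCorr_zero_sub {ω : InfVolFermionState 2} (hω : ω.IsTranslationInvariant) (x y : Site 2) :
    ω.pairCorr S g 0 (y - x) = ω.pairCorr S g x y := by
  have h := hω.pairCorr_add S g 0 (y - x) x
  rw [zero_add, sub_add_cancel] at h
  exact h.symm

/-- **The pair-ODLRO ceiling.** For a translation-invariant `ω`, EVERY finite measure `μ` representing
its pair two-point function `r ↦ ω.pairCorr S g 0 r`, and every finite set of sites `B`:
`|B|² · braggWeight μ ![0] ≤ Σ_{x∈B} Σ_{y∈B} Re ω.pairCorr S g x y`. A certified UPPER bound on the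
right-hand side (one SDP objective, HOME/obs-p1/PAIRCORR-SDP.md (O2)) is a certified ceiling on the pair
ODLRO density. Sewell 1970 §4; Scalapino 1995 §2 eq. (2.4). -/
theorem sq_card_mul_braggWeight_le_sum_re_pairCorr {ω : InfVolFermionState 2} (hω : ω.IsTranslationInvariant)
    (μ : Measure (EuclideanSpace ℝ (Fin 2))) [IsFiniteMeasure μ]
    (hμ : ∀ r : Site 2, ∫ ξ, exp ((∑ i, (r i : ℝ) * ξ i : ℝ) * I) ∂μ = ω.pairCorr S g 0 r)
    (B : Finset (Site 2)) :
    ((B.card : ℝ)) ^ 2 * braggWeight μ ![(0 : Fin 2 → ℝ)] ≤ ∑ x ∈ B, ∑ y ∈ B, (ω.pairCorr S g x y).re := by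
  have h := sq_card_mul_braggWeight_zero_le μ hμ B
  simp_rw [pairCorr_zero_sub S g hω] at h
  exact h

/-- The `d`-wave form: `|B|² · braggWeight μ ![0] ≤ Σ_{x,y∈B} Re ω.dWavePairCorr x y` for every measure
representing `r ↦ ω.dWavePairCorr 0 r`. -/
theorem sq_card_mul_braggWeight_le_sum_re_dWavePairCorr {ω : InfVolFermionState 2}
    (hω : ω.IsTranslationInvariant) (μ : Measure (EuclideanSpace ℝ (Fin 2))) [IsFiniteMeasure μ]
    (hμ : ∀ r : Site 2, ∫ ξ, exp ((∑ i, (r i : ℝ) * ξ i : ℝ) * I) ∂μ = ω.dWavePairCorr 0 r)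
    (B : Finset (Site 2)) :
    ((B.card : ℝ)) ^ 2 * braggWeight μ ![(0 : Fin 2 → ℝ)] ≤
      ∑ x ∈ B, ∑ y ∈ B, (ω.dWavePairCorr x y).re :=
  sq_card_mul_braggWeight_le_sum_re_pairCorr (insert 0 unitSteps) dWaveFormFactor hω μ hμ B

/-- The `B = {x}` rung and the trivial comparator: the pair ODLRO density never exceeds the LOCAL pair
density `Re ω(Φ_0† Φ_0)` (total mass of the spectral measure). With #290-type certified local ceilings this
is today's certified rung `R = 0` of the hierarchy. -/
theorem braggWeight_le_re_pairCorr_self {ω : InfVolFermionState 2}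
    (μ : Measure (EuclideanSpace ℝ (Fin 2))) [IsFiniteMeasure μ]
    (hμ : ∀ r : Site 2, ∫ ξ, exp ((∑ i, (r i : ℝ) * ξ i : ℝ) * I) ∂μ = ω.pairCorr S g 0 r) :
    braggWeight μ ![(0 : Fin 2 → ℝ)] ≤ (ω.pairCorr S g 0 0).re :=
  braggWeight_le_re_zero μ hμ _

/-- **No box beats the local rung kinematically**: for a translation-invariant state the box pair sum
is at most `|B|² · Re ω(Φ_0† Φ_0)` (diagonal dominance, `abs_sum_sum_re_pairCorr_le`), so the ceiling of
`sq_card_mul_braggWeight_le_sum_re_pairCorr` improves on the local rung ONLY through a certificate that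
bounds the off-diagonal pair correlations — the content of the SDP. -/
theorem sum_sum_re_pairCorr_le {ω : InfVolFermionState 2} (hω : ω.IsTranslationInvariant)
    (B : Finset (Site 2)) :
    ∑ x ∈ B, ∑ y ∈ B, (ω.pairCorr S g x y).re ≤ ((B.card : ℝ)) ^ 2 * (ω.pairCorr S g 0 0).re := by
  have h := (abs_le.1 (SingletPair.abs_sum_sum_re_pairCorr_le S g hω B B)).2
  rw [sq]
  exact h

/-- Wiener's identification for the pair channel: the box structure-factor means of the pair two-point
function converge to the Bragg weight at `0` of ANY representing measure — so `braggWeight μ ![0]` in the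
theorems above is the thermodynamic-limit pair structure factor per site at `Q = 0` (the pair ODLRO
density), independently of the choice of `μ`. -/
theorem tendsto_boxPairMean_re_pairBraggWeight {ω : InfVolFermionState 2}
    (μ : Measure (EuclideanSpace ℝ (Fin 2))) [IsFiniteMeasure μ]
    (hμ : ∀ r : Site 2, ∫ ξ, exp ((∑ i, (r i : ℝ) * ξ i : ℝ) * I) ∂μ = ω.pairCorr S g 0 r) :
    Tendsto (fun M => (boxPairMean (fun r : Fin 2 → ℤ => ω.pairCorr S g 0 r) 0 M).re) atTop
      (𝓝 (braggWeight μ ![(0 : Fin 2 → ℝ)])) :=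
  tendsto_boxPairMean_re_braggWeight μ hμ 0

end Pair

/-! ## §3  The certificate side: the box pair word and the row ⇒ ceiling edges -/

section Word

open Matrix Literature.MathematicalPhysics.QuantumLattice Literature.Probability.LatticeModels
open Literature.MathematicalPhysics.QuantumLattice.HubbardWave0 ThermodynamicLimit

variable (S : Finset (Site 2)) (g : Site 2 → ℝ)

/-- **The box pair WORD** `Σ_{x∈B} Σ_{y∈B} Γ(Φ_x)† Γ(Φ_y)` in the window `⋃_{x∈B} pairRegion S x`: the
objective of the pair-ODLRO certificate (PAIRCORR-SDP.md (O2): for `B = [0,R]²` its expectation is the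
Fejér-weighted window sum `Σ_{|r|∞≤R} (R+1−|r₁|)(R+1−|r₂|) Pd_r` of a translation-invariant state).
Scalapino 1995 §2 eq. (2.4) (the pair structure factor). -/
def pairBoxWord (B : Finset (Site 2)) : FermionOp (B.biUnion (pairRegion S)) :=
  ∑ x ∈ B.attach, ∑ y ∈ B.attach,
    fermionEmbed (PolySite.incl (Finset.subset_biUnion_of_mem (pairRegion S) x.2)) (localPairAt S g x)ᴴ *
      fermionEmbed (PolySite.incl (Finset.subset_biUnion_of_mem (pairRegion S) y.2)) (localPairAt S g y)

/-- **Its expectation is the box pair sum**: `ω(pairBoxWord S g B) = Σ_{x,y∈B} ω.pairCorr S g x y`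
(linearity of `ω_Λ` and isotony, `corr_eq_expect_of_subset`). -/
theorem expect_pairBoxWord (ω : InfVolFermionState 2) (B : Finset (Site 2)) :
    ω.expect (B.biUnion (pairRegion S)) (pairBoxWord S g B) = ∑ x ∈ B, ∑ y ∈ B, ω.pairCorr S g x y := by
  unfold pairBoxWord
  rw [map_sum]
  have hx : ∀ x ∈ B.attach, ω.expect (B.biUnion (pairRegion S)) (∑ y ∈ B.attach,
      fermionEmbed (PolySite.incl (Finset.subset_biUnion_of_mem (pairRegion S) x.2)) (localPairAt S g x)ᴴ *
        fermionEmbed (PolySite.incl (Finset.subset_biUnion_of_mem (pairRegion S) y.2)) (localPairAt S g y)) =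
      ∑ y ∈ B.attach, ω.pairCorr S g x y := by
    intro x _
    rw [map_sum]
    exact Finset.sum_congr rfl fun y _ => (ω.corr_eq_expect_of_subset _ _ _ _).symm
  rw [Finset.sum_congr rfl hx,
    Finset.sum_attach B (fun x => ∑ y ∈ B.attach, ω.pairCorr S g x (y : Site 2))]
  exact Finset.sum_congr rfl fun x _ => Finset.sum_attach B (fun y => ω.pairCorr S g x y)

/-- Real parts: `Re ω(pairBoxWord S g B) = Σ_{x,y∈B} Re ω.pairCorr S g x y`. -/
theorem re_expect_pairBoxWord (ω : InfVolFermionState 2) (B : Finset (Site 2)) :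
    (ω.expect (B.biUnion (pairRegion S)) (pairBoxWord S g B)).re = ∑ x ∈ B, ∑ y ∈ B, (ω.pairCorr S g x y).re := by
  rw [expect_pairBoxWord, Complex.re_sum]
  exact Finset.sum_congr rfl fun x _ => Complex.re_sum _ _

/-- **Row ⇒ pair-ODLRO ceiling (one energy row).** A thermodynamic-limit UPPER cell
`SquareTTPrimeCorrUpperRow tp U n u fu _ (pairBoxWord S g B)` (`Rows/DopedTLCorr.lean`; energy cap `u`)
gives, for every torus limit `ω` of the class with `energyDensityTT' 1 tp U n ≤ u` and EVERY finite measure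
`μ` representing its pair two-point function: `|B|² · braggWeight μ ![0] ≤ fu`. (Torus limits are
translation invariant, `IsTorusLimitOf.isTranslationInvariant`.) -/
theorem sq_card_mul_braggWeight_le_of_pairBox_upperRow {tp U n : ℝ} {u fu : ℚ} {B : Finset (Site 2)}
    (h : SquareTTPrimeCorrUpperRow tp U n u fu (B.biUnion (pairRegion S)) (pairBoxWord S g B))
    (ω : InfVolFermionState 2) (Ls : ℕ → ℕ) (ψ : ∀ L, Fock (Orb (FermionTorus 2 L)))
    (hLs : Tendsto Ls atTop atTop)
    (hψ : ∀ j, IsGroundStateInSector (hubbardTorusTT' (Ls j) 1 tp U) (rectN n (Ls j)) 0 (ψ (Ls j)))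
    (hψ1 : ∀ j, star (ψ (Ls j)) ⬝ᵥ ψ (Ls j) = 1) (hω : ω.IsTorusLimitOf ψ Ls)
    (hu : energyDensityTT' 1 tp U n ≤ ((u : ℚ) : ℝ))
    (μ : Measure (EuclideanSpace ℝ (Fin 2))) [IsFiniteMeasure μ]
    (hμ : ∀ r : Site 2, ∫ ξ, exp ((∑ i, (r i : ℝ) * ξ i : ℝ) * I) ∂μ = ω.pairCorr S g 0 r) :
    ((B.card : ℝ)) ^ 2 * braggWeight μ ![(0 : Fin 2 → ℝ)] ≤ ((fu : ℚ) : ℝ) := by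
  have hrow := h ω Ls ψ hLs hψ hψ1 hω hu
  rw [re_expect_pairBoxWord] at hrow
  exact (sq_card_mul_braggWeight_le_sum_re_pairCorr S g hω.isTranslationInvariant μ hμ B).trans hrow

/-- Normalised: under the same hypotheses with `B` nonempty, `braggWeight μ ![0] ≤ fu / |B|²`. -/
theorem braggWeight_le_of_pairBox_upperRow {tp U n : ℝ} {u fu : ℚ} {B : Finset (Site 2)} (hB : B.Nonempty)
    (h : SquareTTPrimeCorrUpperRow tp U n u fu (B.biUnion (pairRegion S)) (pairBoxWord S g B))
    (ω : InfVolFermionState 2) (Ls : ℕ → ℕ) (ψ : ∀ L, Fock (Orb (FermionTorus 2 L)))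
    (hLs : Tendsto Ls atTop atTop)
    (hψ : ∀ j, IsGroundStateInSector (hubbardTorusTT' (Ls j) 1 tp U) (rectN n (Ls j)) 0 (ψ (Ls j)))
    (hψ1 : ∀ j, star (ψ (Ls j)) ⬝ᵥ ψ (Ls j) = 1) (hω : ω.IsTorusLimitOf ψ Ls)
    (hu : energyDensityTT' 1 tp U n ≤ ((u : ℚ) : ℝ))
    (μ : Measure (EuclideanSpace ℝ (Fin 2))) [IsFiniteMeasure μ]
    (hμ : ∀ r : Site 2, ∫ ξ, exp ((∑ i, (r i : ℝ) * ξ i : ℝ) * I) ∂μ = ω.pairCorr S g 0 r) :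
    braggWeight μ ![(0 : Fin 2 → ℝ)] ≤ ((fu : ℚ) : ℝ) / ((B.card : ℝ)) ^ 2 := by
  have hpos : 0 < ((B.card : ℝ)) ^ 2 := by
    have : 0 < (B.card : ℝ) := by exact_mod_cast hB.card_pos
    positivity
  rw [le_div_iff₀ hpos, mul_comm]
  exact sq_card_mul_braggWeight_le_of_pairBox_upperRow S g h ω Ls ψ hLs hψ hψ1 hω hu μ hμ

/-- **M3′ d-wave form** (`U = 8`, `n = 7/8`, hopping `tp`): an `M3CorrUpperRow tp u fu _ (pairBoxWord ({0} ∪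
unitSteps) g_d B)` cell with its energy cap discharged by a typed `M3EnergyUpperRow tp hi`, `hi ≤ u`, gives
`braggWeight μ ![0] ≤ fu / |B|²` for every torus-limit ground state of the M3′ class and every measure
representing its `d`-wave pair two-point function `r ↦ ω.dWavePairCorr 0 r` — a certified thermodynamic-limit
ceiling on the `d`-wave pair ODLRO density. HONEST: a ceiling says nothing about the presence of pairing. -/
theorem m3_dWavePair_braggWeight_le_of_upperRow {tp : ℝ} {u hi fu : ℚ} {B : Finset (Site 2)} (hB : B.Nonempty)
    (h : M3CorrUpperRow tp u fu (B.biUnion (pairRegion (insert 0 unitSteps)))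
      (pairBoxWord (insert 0 unitSteps) dWaveFormFactor B))
    (hE : M3EnergyUpperRow tp hi) (hhi : hi ≤ u)
    (ω : InfVolFermionState 2) (Ls : ℕ → ℕ) (ψ : ∀ L, Fock (Orb (FermionTorus 2 L)))
    (hLs : Tendsto Ls atTop atTop)
    (hψ : ∀ j, IsGroundStateInSector (hubbardTorusTT' (Ls j) 1 tp 8) (rectN (7 / 8) (Ls j)) 0 (ψ (Ls j)))
    (hψ1 : ∀ j, star (ψ (Ls j)) ⬝ᵥ ψ (Ls j) = 1) (hω : ω.IsTorusLimitOf ψ Ls)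
    (μ : Measure (EuclideanSpace ℝ (Fin 2))) [IsFiniteMeasure μ]
    (hμ : ∀ r : Site 2, ∫ ξ, exp ((∑ i, (r i : ℝ) * ξ i : ℝ) * I) ∂μ = ω.dWavePairCorr 0 r) :
    braggWeight μ ![(0 : Fin 2 → ℝ)] ≤ ((fu : ℚ) : ℝ) / ((B.card : ℝ)) ^ 2 :=
  braggWeight_le_of_pairBox_upperRow (insert 0 unitSteps) dWaveFormFactor hB h ω Ls ψ hLs hψ hψ1 hω
    ((show energyDensityTT' 1 tp 8 (7 / 8) ≤ ((hi : ℚ) : ℝ) from hE).trans (by exact_mod_cast hhi)) μ hμ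

end Word

end Summit.Ventures.CertifiedManyBodySolver.Observables

end
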